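import Summits.QuantumFields.BalabanUV.T4Continuum.Support.NE7K1LinTorusSymbolReal
import Literature.MathematicalPhysics.QuantumFieldTheory.Balaban1983to89.B4Strip

/-!
# NE7K1LinTorusFineWaves — row NE7 (node U5), candidate route HOM, path H1L, cell K1-lin(s): FINE PLANE WAVES OVER THE
# `L`-BLOCKS — block means, their modulus `|w_k|² = U_L(k; θ)` (B4 (2.45)'s alias weight, fill-in included), and fibre
# completeness (NEEDS-ESTIMATE #E1, B-E1 — the Fourier kit of lens 2's S-69-1 THEOREM I, steps (3a)(3b)(3c))

Lineage `b2b-balaban-t4-ne7-p2` (CRUX PROVER NE7 #2), generation 75; file 56.  Lens 2 (t4-ne7-idea-2 g69,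
`t4/ideate/NE7/lens2-g69/IDENT-SUPPLY.md` = S-69-1) located the one untyped DOCKING LINK of B-E1: the finite-torus symbol
`σ₁(p)` of the hard block-mean Schur complement (files 30–37, `NE7K1LinTorusLineSymbol.torSymb … 1`) IS the sample
`n²·k_L(θ(p))` of the continuum multiplier `k_L = Δ^ξ_L ∕ 𝓝_L` of files 47–48 at the torus' dual momenta
`θ(p)_μ = 2πp_μ∕P_μ`.  Its proof needs three finite geometric-sum identities about the plane waves of the FINE torus
(period `P′ = L·P`) on the alias FIBRE `q_k = p + P∘k`, `k ∈ (ℤ∕L)^{d+1}`, of a coarse dual index `p`.  THIS FILE proves them: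

* §1 two one-dimensional sums: the ROOT-OF-UNITY SUM `Σ_{t<L} e^{2πi·tz∕L} = L·[L ∣ z]` (`sum_rootUnity`) and the FEJÉR
  MODULUS IDENTITY `|Σ_{t<L} e^{iφt}|²·(2 − 2cos φ) = 2 − 2cos(Lφ)` (`normSq_sum_exp_mul_S1r`), whence
  **`normSq_mean_exp_eq_uFactorr`**: `|L⁻¹Σ_{t<L} e^{it(θ+2πk)∕L}|² = uFactorr L k θ` — `B4Strip`'s factor of the alias
  weight `|u(p′+l)|²` INCLUDING its fill-in value `1` at `θ = 0, k = 0` (hypothesis: `S_ξ(θ + 2πk) = 0` only there).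
* §2 characters: `chiT_add_left` (multiplicative in the dual index), `chiT_eq_prod` (product over coordinates).
* §3 the fibre momenta `fibMom P p k = p + P∘k` and the fine waves on blocks: **`chiT_fib_finePt`**
  `e_{q_k}(Lβ + j) = χ_p(β)·e_{q_k}(j)` (the corner phase is the COARSE character — integer phases drop), `chiT_fibMom`
  (`e_{q_k} = e_{q_0}·ω_k`, `ω_k` a character of `(ℤ∕L)^{d+1}`).
* §4 the BLOCK MEAN `wMean L P p k = L^{−(d+1)}Σ_{j∈[0,L)^{d+1}} e_{q_k}(j)` and (3a) **`sum_chart_fibWave`**: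
  `Σ_j e_{q_k}(rchart β j) = L^{d+1}·w_k·χ_p(β)` on every block of a block-union region.
* §5 `sum_eq_sum_blocks_complex` (`NE7K1LinBlockCoords.sum_eq_sum_blocks` for complex summands).
(3b) `|w_k|² = Ur L k θ(p)` and (3c) fibre completeness are file 57 (`NE7K1LinTorusFineWavesFibre`).

HONEST FRAMING: [folklore] finite Fourier analysis on a discrete torus (in-tree variants on the `ZMod` torus:
`King1986.TorusBlockForm.sum_chi_site`, `King1986.EffectiveLaplacianSymbol.norm_sq_u_pOf`; here on representatives
`boxDom`, over the tree's block charts `rchart`); no estimate; nothing of Bałaban's asserted; no `sorry`.  Census only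
(B-E1's identification, Fourier half, part 1; part 2 is file 57, the KKT assembly file 58); NE7 NOT PRINTED ∕ NOT PROVED; spine 0∕9; FIXED FINITE
T⁴, rung (B)+1; NOT infinite volume, NOT mass gap, NOT Clay.  HONEST DEPENDENCY: continuum YM on T⁴ ⇐ BetaPertH ∧ nine
spine estimates (0/9 proved); BetaPertH ⇐ (D1) ∧ (D4) ∧ CAP+tail; G-an2-4 gates asym, D1 and NE2/3/4.
-/

noncomputable section

open Finset Matrix Complex

namespace Summit.QuantumFields.BalabanUV.T4Continuum.NE7K1LinTorusFineWaves

open Literature.MathematicalPhysics.QuantumFieldTheory.Balaban1983to89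
open Literature.MathematicalPhysics.QuantumFieldTheory.Balaban1983to89.B4Reflection242
open Literature.MathematicalPhysics.QuantumFieldTheory.Balaban1983to89.B4Lower18
open Literature.MathematicalPhysics.QuantumFieldTheory.Balaban1983to89.B4Green244 (finePt)
open Literature.MathematicalPhysics.QuantumFieldTheory.Balaban1983to89.B4Strip (S1r Sxir uFactorr Ur)
open NE7K1LinTorusLineSymbol NE7K1LinTorusSymbolReal

variable {d : ℕ}

/-! ### §1 Two one-dimensional sums -/

/-- **ROOT-OF-UNITY SUM**: `Σ_{t<L} exp(2πi·t·z∕L) = L` if `L ∣ z`, `0` otherwise (`L ≥ 1`). [folklore] -/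
theorem sum_rootUnity {L : ℕ} (hL : 1 ≤ L) (z : ℤ) :
    ∑ t : Fin L, Complex.exp ((((t : ℕ) * z : ℤ) : ℂ) / (L : ℂ) * (2 * Real.pi * Complex.I)) =
      if (L : ℤ) ∣ z then (L : ℂ) else 0 := by
  have hL0 : (L : ℂ) ≠ 0 := by exact_mod_cast (show L ≠ 0 by omega)
  set x : ℂ := Complex.exp ((z : ℂ) / (L : ℂ) * (2 * Real.pi * Complex.I)) with hx
  have hterm : ∀ t : Fin L, Complex.exp ((((t : ℕ) * z : ℤ) : ℂ) / (L : ℂ) * (2 * Real.pi * Complex.I)) = x ^ (t : ℕ) := by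
    intro t
    rw [hx, ← Complex.exp_nat_mul]
    congr 1
    push_cast
    ring
  simp_rw [hterm]
  rw [← Finset.sum_range (fun i => x ^ i)]
  have hxL : x ^ L = 1 := by
    rw [hx, ← Complex.exp_nat_mul]
    have e : (L : ℂ) * ((z : ℂ) / (L : ℂ) * (2 * Real.pi * Complex.I)) = (z : ℂ) * (2 * Real.pi * Complex.I) := by
      field_simp
    rw [e]
    exact Complex.exp_int_mul_two_pi_mul_I z
  split_ifs with hdvd
  · obtain ⟨m, rfl⟩ := hdvd
    have hx1 : x = 1 := by
      rw [hx]
      have e : (((L : ℤ) * m : ℤ) : ℂ) / (L : ℂ) * (2 * Real.pi * Complex.I) = (m : ℂ) * (2 * Real.pi * Complex.I) := by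
        push_cast
        field_simp
      rw [e]
      exact Complex.exp_int_mul_two_pi_mul_I m
    simp [hx1]
  · have hx1 : x ≠ 1 := by
      intro h1
      rw [hx, Complex.exp_eq_one_iff] at h1
      obtain ⟨m, hm⟩ := h1
      have h2pi : (2 * Real.pi * Complex.I) ≠ 0 := by
        have : (Real.pi : ℂ) ≠ 0 := by exact_mod_cast Real.pi_ne_zero
        simp [this, Complex.I_ne_zero]
      have h3 : (z : ℂ) / (L : ℂ) = (m : ℂ) := mul_right_cancel₀ h2pi hm
      rw [div_eq_iff hL0] at h3
      apply hdvd
      refine ⟨m, ?_⟩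
      have h4 : (z : ℂ) = ((m * L : ℤ) : ℂ) := by rw [h3]; push_cast; ring
      have h5 : z = m * L := by exact_mod_cast h4
      rw [h5]; ring
    rw [geom_sum_eq hx1, hxL, sub_self, zero_div]

/-- `|e^{iφ} − 1|² = 2 − 2cos φ`. [folklore] -/
theorem normSq_exp_mul_I_sub_one (φ : ℝ) : Complex.normSq (Complex.exp ((φ : ℂ) * Complex.I) - 1) = S1r φ := by
  rw [Complex.normSq_apply, Complex.sub_re, Complex.sub_im, Complex.exp_ofReal_mul_I_re, Complex.exp_ofReal_mul_I_im,
    Complex.one_re, Complex.one_im, S1r]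
  nlinarith [Real.sin_sq_add_cos_sq φ]

/-- **FEJÉR's MODULUS IDENTITY**: `|Σ_{t<L} e^{iφt}|²·(2 − 2cos φ) = 2 − 2cos(Lφ)` (the geometric sum
`(Σ_{t<L} z^t)(z − 1) = z^L − 1` in squared modulus; cf. `NE7BlockDefectSymbol.fejer_identity`). [folklore] -/
theorem normSq_sum_exp_mul_S1r (L : ℕ) (φ : ℝ) :
    Complex.normSq (∑ t : Fin L, Complex.exp ((t : ℕ) * (φ : ℂ) * Complex.I)) * S1r φ = S1r (L * φ) := by
  set x : ℂ := Complex.exp ((φ : ℂ) * Complex.I) with hx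
  have hterm : ∀ t : Fin L, Complex.exp ((t : ℕ) * (φ : ℂ) * Complex.I) = x ^ (t : ℕ) := by
    intro t
    rw [hx, ← Complex.exp_nat_mul, mul_assoc]
  simp_rw [hterm]
  rw [← Finset.sum_range (fun i => x ^ i)]
  have hgeom : (∑ i ∈ range L, x ^ i) * (x - 1) = x ^ L - 1 := geom_sum_mul x L
  have hxL : x ^ L = Complex.exp (((L * φ : ℝ) : ℂ) * Complex.I) := by
    rw [hx, ← Complex.exp_nat_mul]
    congr 1
    push_cast
    ring
  have h := congrArg Complex.normSq hgeom
  rw [Complex.normSq_mul, hx, normSq_exp_mul_I_sub_one, ← hx, hxL, normSq_exp_mul_I_sub_one] at h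
  exact h

/-- `S_ξ(Lφ) = L²·S₁(φ)` (`ξ = 1∕L`). [folklore] -/
theorem Sxir_mul_left {L : ℕ} (hL : 1 ≤ L) (φ : ℝ) : Sxir L (L * φ) = (L : ℝ) ^ 2 * S1r φ := by
  have hL0 : (L : ℝ) ≠ 0 := by exact_mod_cast (show L ≠ 0 by omega)
  rw [Sxir, S1r, show (L : ℝ) * φ / L = φ by field_simp]

/-- `S₁` is `2π`-periodic (integer multiples). [folklore] -/
theorem S1r_add_nat_mul_two_pi (θ : ℝ) (k : ℕ) : S1r (θ + 2 * Real.pi * k) = S1r θ := by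
  rw [S1r, S1r, show θ + 2 * Real.pi * k = θ + (k : ℤ) * (2 * Real.pi) by push_cast; ring,
    Real.cos_add_int_mul_two_pi]

/-- **THE MODULUS OF A BLOCK MEAN, ONE COORDINATE**: `|L⁻¹Σ_{t<L} e^{it(θ+2πk)∕L}|² = uFactorr L k θ` — `B4Strip`'s factor of
the alias weight, INCLUDING its fill-in `1` at `θ = 0, k = 0`; hypothesis: `S_ξ(θ + 2πk)` vanishes only there. [folklore] -/
theorem normSq_mean_exp_eq_uFactorr {L : ℕ} (hL : 1 ≤ L) (θ : ℝ) (k : ℕ)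
    (h : Sxir L (θ + 2 * Real.pi * k) = 0 → θ = 0 ∧ k = 0) :
    Complex.normSq (((L : ℂ))⁻¹ * ∑ t : Fin L, Complex.exp ((t : ℕ) * (((θ + 2 * Real.pi * k) / L : ℝ) : ℂ) * Complex.I)) =
      uFactorr L k θ := by
  have hL0 : (L : ℝ) ≠ 0 := by exact_mod_cast (show L ≠ 0 by omega)
  by_cases hS : Sxir L (θ + 2 * Real.pi * k) = 0
  · obtain ⟨rfl, rfl⟩ := h hS
    have e : ((0 + 2 * Real.pi * ((0 : ℕ) : ℝ)) / L : ℝ) = 0 := by simp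
    rw [e]
    simp only [Complex.ofReal_zero, mul_zero, zero_mul, Complex.exp_zero, Finset.sum_const, Finset.card_univ,
      Fintype.card_fin, nsmul_eq_mul, mul_one]
    rw [inv_mul_cancel₀ (by exact_mod_cast (show L ≠ 0 by omega)), map_one, uFactorr]
    simp
  · set φ : ℝ := (θ + 2 * Real.pi * k) / L with hφ
    have hLφ : (L : ℝ) * φ = θ + 2 * Real.pi * k := by rw [hφ]; field_simp
    have hSx : Sxir L (θ + 2 * Real.pi * k) = (L : ℝ) ^ 2 * S1r φ := by rw [← hLφ, Sxir_mul_left hL]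
    have hS1 : S1r φ ≠ 0 := by
      intro h0; exact hS (by rw [hSx, h0, mul_zero])
    have hmain := normSq_sum_exp_mul_S1r L φ
    rw [hLφ, S1r_add_nat_mul_two_pi] at hmain
    have hns : Complex.normSq (∑ t : Fin L, Complex.exp ((t : ℕ) * (φ : ℂ) * Complex.I)) = S1r θ / S1r φ := by
      rw [eq_div_iff hS1, hmain]
    rw [Complex.normSq_mul, hns, Complex.normSq_inv, Complex.normSq_natCast]
    -- the `uFactorr` branches
    have huf : uFactorr L k θ = S1r θ / Sxir L (θ + 2 * Real.pi * k) := by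
      unfold uFactorr
      by_cases hk : k = 0
      · subst hk
        have hθ : θ ≠ 0 := by
          intro hθ0
          apply hS
          rw [hθ0]
          simp [Sxir]
        simp [hθ]
      · simp [hk]
    rw [huf, hSx]
    field_simp

/-! ### §2 Characters: multiplicative in the dual index, product over coordinates -/

/-- characters are multiplicative in the DUAL index: `χ_{p+p′}(y) = χ_p(y)·χ_{p′}(y)`. [folklore] -/
theorem chiT_add_left (P : Fin (d + 1) → ℕ) (p p' y : Fin (d + 1) → ℤ) :
    chiT P (p + p') y = chiT P p y * chiT P p' y := by
  unfold chiT
  rw [← Complex.exp_add, ← add_mul, ← Finset.sum_add_distrib]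
  congr 2
  refine Finset.sum_congr rfl fun μ _ => ?_
  simp only [Pi.add_apply]
  push_cast
  ring

/-- a character is the product of its coordinate phases. [folklore] -/
theorem chiT_eq_prod (P : Fin (d + 1) → ℕ) (p y : Fin (d + 1) → ℤ) :
    chiT P p y = ∏ μ, Complex.exp (((p μ * y μ : ℤ) : ℂ) / (P μ : ℂ) * (2 * Real.pi * Complex.I)) := by
  unfold chiT
  rw [Finset.sum_mul, Complex.exp_sum]

/-- `χ_p(0) = 1`. [folklore] -/
theorem chiT_zero_right (P : Fin (d + 1) → ℕ) (p : Fin (d + 1) → ℤ) : chiT P p 0 = 1 := by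
  unfold chiT; simp

/-- `conj χ_p(t)·χ_p(j) = χ_p(j − t)`. [folklore] -/
theorem conj_chiT_mul_chiT (P : Fin (d + 1) → ℕ) (p t j : Fin (d + 1) → ℤ) :
    starRingEnd ℂ (chiT P p t) * chiT P p j = chiT P p (j - t) := by
  have e : chiT P p j = chiT P p (j - t) * chiT P p t := by rw [← chiT_add, sub_add_cancel]
  rw [e, mul_comm, mul_assoc, chiT_mul_conj, mul_one]

/-! ### §3 The fibre momenta `q_k = p + P∘k` and fine waves on blocks -/

section Fibre

variable {L : ℕ} [NeZero L] {Pf Pc : Fin (d + 1) → ℕ}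

/-- an offset ∕ residue vector `k ∈ (Fin L)^{d+1}` as an integer vector. [folklore] -/
def kvec (k : Fin (d + 1) → Fin L) : Fin (d + 1) → ℤ := fun μ => ((k μ : ℕ) : ℤ)

/-- THE FIBRE MOMENTUM `q_k = p + P∘k` (`(P∘k)_μ = P_μ·k_μ`): the `L^{d+1}` dual indices of the fine torus (period `L·P`)
restricting to the coarse dual index `p` (period `P`). [folklore] -/
def fibMom (Pc : Fin (d + 1) → ℕ) (p : Fin (d + 1) → ℤ) (k : Fin (d + 1) → Fin L) : Fin (d + 1) → ℤ :=
  p + fun μ => (Pc μ : ℤ) * kvec k μ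

/-- THE COARSE-UNIT MOMENTUM `θ(p)_μ = 2π·p_μ∕P_μ` of a dual index. [folklore] -/
def thetaOf (Pc : Fin (d + 1) → ℕ) (p : Fin (d + 1) → ℤ) : Fin (d + 1) → ℝ :=
  fun μ => 2 * Real.pi * p μ / Pc μ

/-- **THE CORNER PHASE IS THE COARSE CHARACTER**: `e_{q_k}(L·β) = χ_p(β)` (the alias part contributes an integer phase).
[folklore] -/
theorem chiT_fib_corner (hPf : Pf = fun i => L * Pc i) (hPc : ∀ i, 1 ≤ Pc i) (p : Fin (d + 1) → ℤ)
    (k : Fin (d + 1) → Fin L) (β : Fin (d + 1) → ℤ) :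
    chiT Pf (fibMom Pc p k) (fun μ => (L : ℤ) * β μ) = chiT Pc p β := by
  subst hPf
  unfold chiT
  have hL0 : (L : ℂ) ≠ 0 := by exact_mod_cast NeZero.ne L
  have e : ∑ μ, ((fibMom Pc p k μ * ((L : ℤ) * β μ) : ℤ) : ℂ) / ((L * Pc μ : ℕ) : ℂ) =
      ∑ μ, ((p μ * β μ : ℤ) : ℂ) / (Pc μ : ℂ) + ((∑ μ, kvec k μ * β μ : ℤ) : ℂ) := by
    push_cast
    rw [← Finset.sum_add_distrib]
    refine Finset.sum_congr rfl fun μ _ => ?_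
    have hP0 : (Pc μ : ℂ) ≠ 0 := by exact_mod_cast (show Pc μ ≠ 0 by have := hPc μ; omega)
    simp only [fibMom, Pi.add_apply]
    push_cast
    field_simp
  rw [e, add_mul, Complex.exp_add, Complex.exp_int_mul_two_pi_mul_I, mul_one]

omit [NeZero L] in
/-- `finePt L β j = L·β + j` as integer vectors. [folklore] -/
theorem finePt_eq_add (β : Fin (d + 1) → ℤ) (j : Fin (d + 1) → Fin L) :
    finePt L β j = (fun μ => (L : ℤ) * β μ) + kvec j := by
  funext μ; rfl

/-- **FINE WAVES ON A BLOCK**: `e_{q_k}(Lβ + j) = χ_p(β)·e_{q_k}(j)`. [folklore] -/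
theorem chiT_fib_finePt (hPf : Pf = fun i => L * Pc i) (hPc : ∀ i, 1 ≤ Pc i) (p : Fin (d + 1) → ℤ)
    (k : Fin (d + 1) → Fin L) (β : Fin (d + 1) → ℤ) (j : Fin (d + 1) → Fin L) :
    chiT Pf (fibMom Pc p k) (finePt L β j) = chiT Pc p β * chiT Pf (fibMom Pc p k) (kvec j) := by
  rw [finePt_eq_add, chiT_add, chiT_fib_corner hPf hPc]

/-- **`e_{q_k} = e_{q_0}·ω_k`**: the fibre wave is the base wave times a character of `(ℤ∕L)^{d+1}`. [folklore] -/
theorem chiT_fibMom (hPf : Pf = fun i => L * Pc i) (hPc : ∀ i, 1 ≤ Pc i) (p : Fin (d + 1) → ℤ)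
    (k : Fin (d + 1) → Fin L) (z : Fin (d + 1) → ℤ) :
    chiT Pf (fibMom Pc p k) z = chiT Pf p z * chiT (fun _ => L) (kvec k) z := by
  subst hPf
  rw [fibMom, chiT_add_left]
  congr 1
  unfold chiT
  congr 2
  refine Finset.sum_congr rfl fun μ _ => ?_
  have hP0 : (Pc μ : ℂ) ≠ 0 := by exact_mod_cast (show Pc μ ≠ 0 by have := hPc μ; omega)
  have hL0 : (L : ℂ) ≠ 0 := by exact_mod_cast NeZero.ne L
  push_cast
  field_simp

/-! ### §4 The block mean of a fibre wave and (3a): block sums -/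

/-- THE BLOCK MEAN `w_k(p) = L^{−(d+1)}·Σ_{j ∈ [0,L)^{d+1}} e_{q_k}(j)` of the fibre wave over the block at the origin
(King's alias form factor `u`). [folklore] -/
def wMean (L : ℕ) [NeZero L] (Pc : Fin (d + 1) → ℕ) (p : Fin (d + 1) → ℤ) (k : Fin (d + 1) → Fin L) : ℂ :=
  (((L : ℂ) ^ (d + 1)))⁻¹ * ∑ j : Fin (d + 1) → Fin L, chiT (fun i => L * Pc i) (fibMom Pc p k) (kvec j)

/-- **(3a) BLOCK SUMS OF A FIBRE WAVE**: on every `L`-block `β` of a block-union region,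
`Σ_j e_{q_k}(rchart β j) = L^{d+1}·w_k(p)·χ_p(β)`. [folklore] -/
theorem sum_chart_fibWave (hPf : Pf = fun i => L * Pc i) (hPc : ∀ i, 1 ≤ Pc i) {T : Finset (Fin (d + 1) → ℤ)}
    (hTL : IsBlockUnion L T) (β : ↥(T.image (blk L))) (p : Fin (d + 1) → ℤ) (k : Fin (d + 1) → Fin L) :
    ∑ j : Fin (d + 1) → Fin L, chiT Pf (fibMom Pc p k) (rchart NeZero.one_le hTL β j).1 =
      (L : ℂ) ^ (d + 1) * wMean L Pc p k * chiT Pc p β.1 := by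
  have hL0 : ((L : ℂ) ^ (d + 1)) ≠ 0 := pow_ne_zero _ (by exact_mod_cast NeZero.ne L)
  have e : ∀ j : Fin (d + 1) → Fin L, (rchart NeZero.one_le hTL β j).1 = finePt L β.1 j := fun j => rfl
  simp_rw [e, chiT_fib_finePt hPf hPc]
  rw [← Finset.mul_sum, wMean, ← hPf, ← mul_assoc, mul_inv_cancel₀ hL0, one_mul, mul_comm]

/-- (3a), block-indicator form: `Σ_{x ∈ T, blk x = β} e_{q_k}(x) = L^{d+1}·w_k(p)·χ_p(β)`. [folklore] -/
theorem sum_block_fibWave (hPf : Pf = fun i => L * Pc i) (hPc : ∀ i, 1 ≤ Pc i) {T : Finset (Fin (d + 1) → ℤ)}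
    (hTL : IsBlockUnion L T) (β : ↥(T.image (blk L))) (p : Fin (d + 1) → ℤ) (k : Fin (d + 1) → Fin L) :
    ∑ x ∈ Finset.univ.filter (fun x : ↥T => rblk L T x = β), chiT Pf (fibMom Pc p k) x.1 =
      (L : ℂ) ^ (d + 1) * wMean L Pc p k * chiT Pc p β.1 := by
  classical
  rw [filter_rblk_eq_image NeZero.one_le hTL β,
    Finset.sum_image fun j _ j' _ h => rchart_injective NeZero.one_le hTL β h]
  exact sum_chart_fibWave hPf hPc hTL β p k

end Fibre

/-! ### §5 Sums over a block-union region, by blocks (complex summands) -/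

/-- `Σ_{x′} F x′ = Σ_b Σ_j F(rchart b j)` for complex `F` (`NE7K1LinBlockCoords.sum_eq_sum_blocks`). [folklore] -/
theorem sum_eq_sum_blocks_complex {L : ℕ} [NeZero L] {R' : Finset (Fin (d + 1) → ℤ)} (hR : IsBlockUnion L R')
    (F : ↥R' → ℂ) :
    ∑ x', F x' = ∑ b : ↥(R'.image (blk L)), ∑ j : Fin (d + 1) → Fin L, F (rchart NeZero.one_le hR b j) := by
  classical
  rw [← Finset.sum_fiberwise_of_maps_to (s := Finset.univ) (t := Finset.univ) (g := rblk L R')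
    (fun x _ => Finset.mem_univ _) F]
  refine Finset.sum_congr rfl fun b _ => ?_
  rw [filter_rblk_eq_image NeZero.one_le hR b, Finset.sum_image fun j _ j' _ h => rchart_injective NeZero.one_le hR b h]

end Summit.QuantumFields.BalabanUV.T4Continuum.NE7K1LinTorusFineWaves

end
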